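import Literature.Geometry.Kaehler.ComplexTorusTotalLieAlgebraRatJordanPair
import Literature.Geometry.Kaehler.ComplexTorusTotalLieAlgebraRatDegTwoForms
import Literature.Geometry.Kaehler.ComplexTorusTotalLieAlgebraRatDualLefschetzSpan
import HarnessLib

/-!
# The Lefschetz triple `(𝔤_tot(X; ℚ), h, H²(X; ℚ))` on the rational points, assembled: `𝔞 = H²(X; ℚ) ≅ 𝔤₂(ℚ)` abelian,
# the `𝔰𝔩₂`-triples `(e_η, h, f_η)` on the domain of `f`, and generation by `e(𝔞)` and the image of `f`
# (Looijenga–Lunts 1997, §1 (1.1), (1.9), §3 (3.3))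

Layer `Literature/Geometry/Kaehler`, namespace `Literature.Geometry.Kaehler.ComplexTorus`; lane `lit-hodgefound` (Track 2
foundations library, Layer A: Hodge theory of complex tori on invariant forms), skeleton seat `lit-hodgefound-skel-1`
(generation 37), row **A1-83** of `run/shared/lean/pub/lit-hodgefound/SKELETON.md`.  A CAPSTONE BY NAME (nothing restated, every
clause is a one-line appeal to a landed row) of rows A1-75 (`ComplexTorusTotalLieAlgebraRatGrading`: the grading, dimensions),
A1-79 (`ComplexTorusTotalLieAlgebraRatJordanPair`: `mem_totalLieAlgebraRat_iff_forall_lie_closed` — `𝔤_tot(X; ℚ)` is the smallest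
commutator-closed `ℚ`-subspace containing `𝔤₂(ℚ) ∪ 𝔤₋₂(ℚ)`), A1-80 (`ComplexTorusTotalLieAlgebraRatDegTwoForms`: `𝔤₂(ℚ) =
e(H²(X; ℚ)) ≅ H²(X; ℚ)`, abelian), A1-81 (`ComplexTorusTotalLieAlgebraRatDualLefschetz`: `f_η ∈ 𝔤₋₂(ℚ)` and the `𝔰𝔩₂`-triples on
the domain of `f`) and A1-82 (`ComplexTorusTotalLieAlgebraRatDualLefschetzSpan`: `𝔤₋₂(ℚ) = span_ℚ f(dom f)`, `dom f ≠ ∅`).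
THEOREMS ONLY: no definition, no instance, no local instance attribute, no named fact, no `sorry` (D-0026 net debt `0`).

## Source, VERBATIM

E. Looijenga, V. A. Lunts, *A Lie algebra attached to a projective variety*, Invent. Math. **129** (1997) 361–412 (held
text `paper:arxiv-alg-geom_9604014`; page/line numbers of that text):

> (§1, p0007 L55–L82) "suppose that conversely, we are given a semisimple Lie algebra `𝔤`, a simple element `h ∈ 𝔤` (in
> the sense of appearing as the middle element of an `𝔰𝔩₂`-triple) and an abelian subalgebra `𝔞` of `𝔤` such that
> **(i)** the adjoint representation of `𝔤` makes `𝔤` a Lefschetz module over `𝔞`, i.e., there is a rational map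
> `f : 𝔞 → 𝔤₋₂` so that for `e` in the domain of `f`, we have an `𝔰𝔩(2)`-triple `(e, h, f_e)` and **(ii)** `𝔤` is as a Lie
> algebra generated by `𝔞` and the image of `f`. […] We shall call such a triple a Lefschetz triple and its first two
> items, `(𝔤, h)`, a Lefschetz pair."
> (§1 (1.9), p0006 L119–L122) "we often write `𝔤_*(X; K)` for the corresponding Lie algebra of `K`-points."
> (§3 (3.3), p0013 L110–L115) "There is a natural identification `(𝔤_tot(X; ℝ), h) ≅ (𝔰𝔬(V^* ⊕ V), u)` […]. Furthermore,
> `H^ev(X)[n]` is a semispinorial representation of `𝔤_tot(X; ℝ)` and a fundamental Jordan–Lefschetz module of `H²(X, ℝ)`."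

## What is formalised (all `theorem`s, proved; `g ≥ 2` unless noted)

* `totalLieAlgebraRatDeg_two_le_of_forall_lefschetzG_mem` (every torus) / `totalLieAlgebraRatDeg_negTwo_le_of_forall_lefschetzDualG_mem`:
  a `ℚ`-subspace containing `e(H²(X; ℚ))` resp. `f(dom f)` contains `𝔤₂(ℚ)` resp. `𝔤₋₂(ℚ)`.
* **`mem_totalLieAlgebraRat_iff_forall_lefschetz_closed` — CLAUSE (ii) ON THE RATIONAL POINTS: `T ∈ 𝔤_tot(X; ℚ)` iff `T` lies in
  every commutator-closed `ℚ`-subspace of `𝔤𝔩_ℂ(H•(X; ℂ))` containing all `e_γ` (`γ ∈ H²(X; ℚ)`) and all `f_η` (`η ∈ H²(X; ℚ)` real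
  non-degenerate)**; `lefschetzG_lefschetzDualG_mem_totalLieAlgebraRat` (the trivial half, every torus).
* **`lefschetzTriple_totalLieAlgebraRat` — THE ASSEMBLED TRIPLE**: (𝔞) `𝔤₂(ℚ) = e(H²(X; ℚ))`, `e` inverted by `T ↦ T(1)₂`, `𝔤₂(ℚ)`
  abelian; (h) `h ∈ 𝔤₀(ℚ)` and the domain of `f` is non-empty (so `h` is simple); (i) the `𝔰𝔩₂`-triples `(e_η, h, f_η)`,
  `e_η ∈ 𝔤₂(ℚ)`, `f_η ∈ 𝔤₋₂(ℚ)`, on the domain of `f`; (ii) generation.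
* `finrank_lefschetzTriple_totalLieAlgebraRat`: `dim 𝔞 = dim 𝔤₂(ℚ) = dim span f(dom f) = C(2g, 2)` and `dim 𝔤₋₂ + dim 𝔤₀ + dim 𝔤₂
  = dim 𝔤_tot(X; ℚ)`.
* (2.5) IN `e`/`f` TERMS (`g ≥ 2`): `totalLieAlgebraRatDeg_two_eq_span_lefschetzG`, **`span_lie_eq_span_lie_lefschetzG_lefschetzDualG`
  — `span [𝔤₂(ℚ), 𝔤₋₂(ℚ)] = span {[e_γ, f_η]}`**, **`mem_totalLieAlgebraRat_iff_mem_sup_span_lefschetz` — `𝔤_tot(X; ℚ) =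
  span f(dom f) + span [e(𝔞), f(dom f)] + span e(𝔞)`** (two brackets suffice).
* SATURATION (every torus): **`exists_eq_lefschetzG_reForm_of_lie_countingG_eq_two_smul` — every `T ∈ 𝔤_tot(X; ℚ)` with
  `[h, T] = 2T` (e.g. the head of any `𝔰𝔩₂`-triple `(T, h, f)`) is `e_γ`, `γ ∈ H²(X; ℚ)`** — `𝔞 = H²(X; ℚ)` cannot be enlarged;
  `eq_of_lefschetzG_reForm_eq` (the class `γ` is unique).

## SCOPE (what is NOT claimed)

(a) `g ≥ 2` (the pieces `𝔤_{±2}(ℚ)`, `𝔤₀(ℚ)` are described through `𝔰𝔬(V_ℚ ⊕ V_ℚ^*)`, rows A1-72…A1-75).  (b) No `structure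
LefschetzTriple` is introduced (the tree has none); the clauses are stated as a conjunction of the landed statements;
"semisimple 𝔤" is rows A1-50/A1-51 (`𝔤_tot ≅ 𝔰𝔬`, simple) and is not repeated; "saturated" is rendered as the
degree-`2` exhaustion `{T ∈ 𝔤_tot(X; ℚ) : [h, T] = 2T} = e(H²(X; ℚ))` (no quantification over abelian subalgebras `𝔞'` and
their rational maps `f'` is formalised); "generated as a Lie algebra" is rendered as minimality among commutator-closed
`ℚ`-subspaces (no `LieSubalgebra.lieSpan`, no Lie instance synthesized).  (c) Nothing about `𝔤_NS`, `𝔤_K`, `𝔤_MT`.  (d) Nothing in this file is a case of the Hodge conjecture.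

## References

* [LooijengaLunts1997] E. Looijenga, V. A. Lunts, *A Lie algebra attached to a projective variety*, Invent. Math. 129 (1997)
  361–412; arXiv:alg-geom/9604014. §1 (1.1), (1.9); §2 (2.6); §3 (3.3) (held `paper:arxiv-alg-geom_9604014`, p0006–p0007,
  p0010, p0013).
-/

noncomputable section

-- `Module ℚ` / `Module ℂ` synthesis on `E [⋀^Fin k]→L[ℝ] ℂ`, as in the parent files
set_option maxSynthPendingDepth 3

open Module Function

namespace Literature.Geometry.Kaehler

namespace ComplexTorus

open Literature.LinearAlgebra.Alternating

/-! ### The Lefschetz triple `(𝔤_tot(X; ℚ), h, H²(X; ℚ))` on the rational points, assembled (`g ≥ 2`) -/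

section LefschetzTripleRat

variable {ι : Type*} [Fintype ι] [DecidableEq ι] {E : Type*} [NormedAddCommGroup E] [NormedSpace ℂ E]
  [FiniteDimensional ℂ E] [Nontrivial E] (Φ : (ι → ℝ) ≃L[ℝ] E)

omit [DecidableEq ι] in
/-- A `ℚ`-subspace containing every `e_{Re γ}`, `γ ∈ H²(X; ℚ)`, contains `𝔤_tot(X; ℚ)₂` (row A1-80: `𝔤₂(ℚ) = e(H²(X; ℚ))`).
[cite: LooijengaLunts1997, §1 (1.1), §3 (3.3)] -/
theorem totalLieAlgebraRatDeg_two_le_of_forall_lefschetzG_mem {K : Submodule ℚ (Module.End ℂ (GForm E ℂ))}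
    (he : ∀ γ ∈ rationalForms Φ 2, lefschetzG (reForm γ) ∈ K) : totalLieAlgebraRatDeg Φ 2 ≤ K := fun T hT ↦ by
  obtain ⟨γ, hγ, rfl⟩ := (mem_totalLieAlgebraRatDeg_two_iff_exists_reForm Φ).1 hT
  exact he γ hγ

/-- A `ℚ`-subspace containing every `f_η`, `η ∈ H²(X; ℚ)` real non-degenerate, contains `𝔤_tot(X; ℚ)₋₂` (`g ≥ 2`; row A1-82:
`𝔤₋₂(ℚ) = span_ℚ f(dom f)`). [cite: LooijengaLunts1997, §1 (1.1), §3 proof of (3.3)] -/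
theorem totalLieAlgebraRatDeg_negTwo_le_of_forall_lefschetzDualG_mem (h2 : 2 ≤ finrank ℂ E)
    {K : Submodule ℚ (Module.End ℂ (GForm E ℂ))}
    (hf : ∀ η : E [⋀^Fin 2]→L[ℝ] ℝ, ofRealForm η ∈ rationalForms Φ 2 → (∀ v : E, v ≠ 0 → ∃ w : E, η ![v, w] ≠ 0) →
      lefschetzDualG η ∈ K) : totalLieAlgebraRatDeg Φ (-2) ≤ K := by
  rw [totalLieAlgebraRatDeg_negTwo_eq_span_lefschetzDualG Φ h2]
  refine Submodule.span_le.2 ?_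
  rintro _ ⟨η, hη, hnd, rfl⟩
  exact hf η hη hnd

/-- **CLAUSE (ii) OF THE LEFSCHETZ TRIPLE `(𝔤_tot(X; ℚ), h, H²(X; ℚ))` ON THE RATIONAL POINTS (`g ≥ 2`): `𝔤_tot(X; ℚ)` is, as a
Lie algebra over `ℚ`, generated by `e(𝔞) = {e_γ : γ ∈ H²(X; ℚ)}` and the image `{f_η : η ∈ H²(X; ℚ) non-degenerate}` of `f`** —
`T ∈ 𝔤_tot(X; ℚ)` iff `T` lies in every commutator-closed `ℚ`-subspace of `𝔤𝔩_ℂ(H•(X; ℂ))` containing these operators (rows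
A1-79 `mem_totalLieAlgebraRat_iff_forall_lie_closed`, A1-80, A1-82 combined). [cite: LooijengaLunts1997, §1 (1.1) ("(ii) 𝔤 is as a Lie algebra generated by 𝔞 and the image of f"), (1.9), §3 (3.3) and its proof] -/
theorem mem_totalLieAlgebraRat_iff_forall_lefschetz_closed (h2 : 2 ≤ finrank ℂ E) {T : Module.End ℂ (GForm E ℂ)} :
    T ∈ totalLieAlgebraRat Φ ↔ ∀ K : Submodule ℚ (Module.End ℂ (GForm E ℂ)), (∀ S ∈ K, ∀ T ∈ K, ⁅S, T⁆ ∈ K) →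
      (∀ γ ∈ rationalForms Φ 2, lefschetzG (reForm γ) ∈ K) →
      (∀ η : E [⋀^Fin 2]→L[ℝ] ℝ, ofRealForm η ∈ rationalForms Φ 2 → (∀ v : E, v ≠ 0 → ∃ w : E, η ![v, w] ≠ 0) →
        lefschetzDualG η ∈ K) → T ∈ K := by
  rw [mem_totalLieAlgebraRat_iff_forall_lie_closed Φ h2]
  refine ⟨fun h K hK he hf ↦ h K hK (totalLieAlgebraRatDeg_two_le_of_forall_lefschetzG_mem Φ he)
    (totalLieAlgebraRatDeg_negTwo_le_of_forall_lefschetzDualG_mem Φ h2 hf), fun h K hK h₂ hneg ↦ h K hK ?_ ?_⟩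
  · exact fun γ hγ ↦ h₂ (lefschetzG_reForm_mem_totalLieAlgebraRatDeg_two Φ hγ)
  · exact fun η hη hnd ↦ hneg (lefschetzDualG_mem_totalLieAlgebraRatDeg_negTwo Φ hη hnd)

/-- **`e_γ` and `f_η` GENERATE: every `e_{Re γ}` (`γ ∈ H²(X; ℚ)`) and every `f_η` (`η` rational non-degenerate) lies in
`𝔤_tot(X; ℚ)`, and `𝔤_tot(X; ℚ)` is commutator-closed** — the trivial half of clause (ii), recorded for every torus.
[cite: LooijengaLunts1997, §1 (1.1), (1.9)] -/
theorem lefschetzG_lefschetzDualG_mem_totalLieAlgebraRat :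
    (∀ γ ∈ rationalForms Φ 2, lefschetzG (reForm γ) ∈ totalLieAlgebraRat Φ) ∧
      (∀ η : E [⋀^Fin 2]→L[ℝ] ℝ, ofRealForm η ∈ rationalForms Φ 2 → (∀ v : E, v ≠ 0 → ∃ w : E, η ![v, w] ≠ 0) →
        lefschetzDualG η ∈ totalLieAlgebraRat Φ) ∧
      ∀ S ∈ totalLieAlgebraRat Φ, ∀ T ∈ totalLieAlgebraRat Φ, ⁅S, T⁆ ∈ totalLieAlgebraRat Φ :=
  ⟨fun _ hγ ↦ totalLieAlgebraRatDeg_le Φ 2 (lefschetzG_reForm_mem_totalLieAlgebraRatDeg_two Φ hγ),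
    fun _ hη hnd ↦ lefschetzDualG_mem_totalLieAlgebraRat' Φ hη hnd, fun _ hS _ hT ↦ lie_mem_totalLieAlgebraRat Φ hS hT⟩

/-- **THE LEFSCHETZ TRIPLE `(𝔤_tot(X; ℚ), h, 𝔞 = H²(X; ℚ))` ON THE RATIONAL POINTS, ASSEMBLED** (`g ≥ 2`; rows A1-75, A1-79,
A1-80, A1-81, A1-82 BY NAME):
(𝔞) `e : H²(X; ℚ) → 𝔤_tot(X; ℚ)₂` is a `ℚ`-linear isomorphism onto the degree-`2` piece (row A1-80's `degTwoEquivRationalForms`, here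
through its inverse `T ↦ T(1)`), and `e(𝔞) = 𝔤_tot(X; ℚ)₂` is an ABELIAN subalgebra;
(h) `h ∈ 𝔤_tot(X; ℚ)₀` is SIMPLE: the domain of `f` is non-empty over `ℚ`, so `h` is the middle of an `𝔰𝔩₂`-triple in `𝔤_tot(X; ℚ)`;
(i) for every `η` in the domain of `f` (rational, non-degenerate), `(e_η, h, f_η)` is an `𝔰𝔩₂`-triple with `e_η ∈ 𝔤₂(ℚ)`,
`f_η ∈ 𝔤₋₂(ℚ)`;
(ii) `𝔤_tot(X; ℚ)` is generated, as a Lie algebra over `ℚ`, by `e(𝔞)` and the image of `f`.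
[cite: LooijengaLunts1997, §1 (1.1) (Lefschetz triples), (1.9), §3 (3.3) ("(𝔤_tot(X;ℝ), h) ≅ (𝔰𝔬(V^* ⊕ V), u) … a fundamental Jordan–Lefschetz module of H²(X, ℝ)") and its proof] -/
theorem lefschetzTriple_totalLieAlgebraRat (h2 : 2 ≤ finrank ℂ E) :
    -- (𝔞): `𝔤₂(ℚ) = e(H²(X; ℚ))`, `e` injective with inverse `T ↦ T(1)₂`, and `𝔤₂(ℚ)` abelian
    ((∀ T : Module.End ℂ (GForm E ℂ), T ∈ totalLieAlgebraRatDeg Φ 2 ↔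
        ∃ γ ∈ rationalForms Φ 2, T = lefschetzG (reForm γ)) ∧
      (∀ γ ∈ rationalForms Φ 2, lefschetzG (reForm γ) (GForm.of 0 (Literature.Analysis.Complex.oneForm₀ E)) 2 = γ) ∧
      (∀ S ∈ totalLieAlgebraRatDeg Φ 2, ∀ T ∈ totalLieAlgebraRatDeg Φ 2, ⁅S, T⁆ = 0)) ∧
    -- (h): `h ∈ 𝔤₀(ℚ)` and the domain of `f` is non-empty
    (countingG E ∈ totalLieAlgebraRatDeg Φ 0 ∧
      ∃ η : E [⋀^Fin 2]→L[ℝ] ℝ, ofRealForm η ∈ rationalForms Φ 2 ∧ ∀ v : E, v ≠ 0 → ∃ w : E, η ![v, w] ≠ 0) ∧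
    -- (i): the `𝔰𝔩₂`-triples `(e_η, h, f_η)` on the domain of `f`
    (∀ η : E [⋀^Fin 2]→L[ℝ] ℝ, ofRealForm η ∈ rationalForms Φ 2 → (∀ v : E, v ≠ 0 → ∃ w : E, η ![v, w] ≠ 0) →
      lefschetzG η ∈ totalLieAlgebraRatDeg Φ 2 ∧ lefschetzDualG η ∈ totalLieAlgebraRatDeg Φ (-2) ∧
        ⁅lefschetzG η, lefschetzDualG η⁆ = countingG E ∧ ⁅countingG E, lefschetzG η⁆ = 2 • lefschetzG η ∧
          ⁅countingG E, lefschetzDualG η⁆ = -(2 • lefschetzDualG η)) ∧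
    -- (ii): generation by `e(𝔞)` and the image of `f`
    (∀ T : Module.End ℂ (GForm E ℂ), T ∈ totalLieAlgebraRat Φ ↔
      ∀ K : Submodule ℚ (Module.End ℂ (GForm E ℂ)), (∀ S ∈ K, ∀ T ∈ K, ⁅S, T⁆ ∈ K) →
        (∀ γ ∈ rationalForms Φ 2, lefschetzG (reForm γ) ∈ K) →
        (∀ η : E [⋀^Fin 2]→L[ℝ] ℝ, ofRealForm η ∈ rationalForms Φ 2 → (∀ v : E, v ≠ 0 → ∃ w : E, η ![v, w] ≠ 0) →
          lefschetzDualG η ∈ K) → T ∈ K) := by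
  refine ⟨⟨fun T ↦ mem_totalLieAlgebraRatDeg_two_iff_exists_reForm Φ, fun γ hγ ↦ ?_,
      fun S hS T hT ↦ lie_eq_zero_of_mem_totalLieAlgebraRatDeg_two' Φ hS hT⟩,
    ⟨(countingG_mem_totalLieAlgebraRatDegZero Φ), exists_rational_nondegenerate_twoForm Φ⟩, fun η hη hnd ↦ ?_,
    fun T ↦ mem_totalLieAlgebraRat_iff_forall_lefschetz_closed Φ h2⟩
  · rw [lefschetzG_apply_oneForm₀_two, ofRealForm_reForm_of_mem_rationalForms_two Φ hγ]
  · obtain ⟨⟨he, -, hf⟩, hef, hhe, hhf⟩ := lefschetzTriple_mem_totalLieAlgebraRatDeg Φ hη hnd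
    exact ⟨he, hf, hef, hhe, hhf⟩

/-- **DIMENSION BOOKKEEPING of the triple** (`g ≥ 2`): `dim_ℚ 𝔞 = dim_ℚ H²(X; ℚ) = C(2g, 2) = dim_ℚ 𝔤_tot(X; ℚ)₂ =
dim_ℚ 𝔤_tot(X; ℚ)₋₂ = dim_ℚ span_ℚ f(dom f)`, `dim_ℚ 𝔤_tot(X; ℚ)₀ = (2g)²`, summing to `dim_ℚ 𝔤_tot(X; ℚ) = 2g(4g - 1) =
dim 𝔰𝔬_{4g}` (rows A1-71/A1-75/A1-80/A1-82). [cite: LooijengaLunts1997, §2 (2.6), §3 (3.3)] -/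
theorem finrank_lefschetzTriple_totalLieAlgebraRat (h2 : 2 ≤ finrank ℂ E) :
    finrank ℚ (rationalForms Φ 2) = (2 * finrank ℂ E).choose 2 ∧
      finrank ℚ (totalLieAlgebraRatDeg Φ 2) = (2 * finrank ℂ E).choose 2 ∧
      finrank ℚ (Submodule.span ℚ {T : Module.End ℂ (GForm E ℂ) | ∃ η : E [⋀^Fin 2]→L[ℝ] ℝ,
        ofRealForm η ∈ rationalForms Φ 2 ∧ (∀ v : E, v ≠ 0 → ∃ w : E, η ![v, w] ≠ 0) ∧ T = lefschetzDualG η}) =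
          (2 * finrank ℂ E).choose 2 ∧
      finrank ℚ (totalLieAlgebraRatDeg Φ (-2)) + finrank ℚ (totalLieAlgebraRatDeg Φ 0) +
        finrank ℚ (totalLieAlgebraRatDeg Φ 2) = finrank ℚ (totalLieAlgebraRat Φ) := by
  refine ⟨?_, finrank_totalLieAlgebraRatDeg_two_eq_choose Φ, ?_, finrank_totalLieAlgebraRatDeg_sum Φ h2⟩
  · rw [← finrank_totalLieAlgebraRatDeg_two_eq_finrank_rationalForms, finrank_totalLieAlgebraRatDeg_two_eq_choose]
  · rw [← totalLieAlgebraRatDeg_negTwo_eq_span_lefschetzDualG Φ h2, finrank_totalLieAlgebraRatDeg_negTwo Φ h2]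

/-! ### (2.5) in `e`/`f` terms: `𝔤_tot(X; ℚ) = span f(dom f) + span [e(𝔞), f(dom f)] + e(𝔞)` -/

omit [DecidableEq ι] in
/-- `𝔤_tot(X; ℚ)₂ = span_ℚ e(H²(X; ℚ))` (the set `e(H²(X; ℚ))` is already a `ℚ`-subspace, row A1-80). [cite: LooijengaLunts1997, §1 (1.1), §3 (3.3)] -/
theorem totalLieAlgebraRatDeg_two_eq_span_lefschetzG :
    totalLieAlgebraRatDeg Φ 2 = Submodule.span ℚ {T : Module.End ℂ (GForm E ℂ) |
      ∃ γ ∈ rationalForms Φ 2, T = lefschetzG (reForm γ)} := by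
  refine le_antisymm (fun T hT ↦ ?_) (Submodule.span_le.2 ?_)
  · obtain ⟨γ, hγ, rfl⟩ := (mem_totalLieAlgebraRatDeg_two_iff_exists_reForm Φ).1 hT
    exact Submodule.subset_span ⟨γ, hγ, rfl⟩
  · rintro _ ⟨γ, hγ, rfl⟩
    exact lefschetzG_reForm_mem_totalLieAlgebraRatDeg_two Φ hγ

/-- **`span_ℚ [𝔤₂(ℚ), 𝔤₋₂(ℚ)] = span_ℚ {[e_γ, f_η] : γ ∈ H²(X; ℚ), η ∈ dom f}`** (`g ≥ 2`): the brackets of the two abelian pieces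
are spanned by the brackets of Lefschetz operators with dual Lefschetz operators (row A1-79: this span is `𝔤₀(ℚ)`).
[cite: LooijengaLunts1997, §2 (2.5), §3 proof of (3.6) ("[𝔤₂, 𝔤₋₂] generates 𝔤₀")] -/
theorem span_lie_eq_span_lie_lefschetzG_lefschetzDualG (h2 : 2 ≤ finrank ℂ E) :
    Submodule.span ℚ {P : Module.End ℂ (GForm E ℂ) |
        ∃ S ∈ totalLieAlgebraRatDeg Φ 2, ∃ T ∈ totalLieAlgebraRatDeg Φ (-2), ⁅S, T⁆ = P} =
      Submodule.span ℚ {P : Module.End ℂ (GForm E ℂ) | ∃ γ ∈ rationalForms Φ 2, ∃ η : E [⋀^Fin 2]→L[ℝ] ℝ,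
        ofRealForm η ∈ rationalForms Φ 2 ∧ (∀ v : E, v ≠ 0 → ∃ w : E, η ![v, w] ≠ 0) ∧
          ⁅lefschetzG (reForm γ), lefschetzDualG η⁆ = P} := by
  refine le_antisymm (Submodule.span_le.2 ?_) (Submodule.span_mono ?_)
  · rintro _ ⟨S, hS, T, hT, rfl⟩
    obtain ⟨γ, hγ, rfl⟩ := (mem_totalLieAlgebraRatDeg_two_iff_exists_reForm Φ).1 hS
    rw [totalLieAlgebraRatDeg_negTwo_eq_span_lefschetzDualG Φ h2] at hT
    refine Submodule.span_induction (p := fun T _ ↦ ⁅lefschetzG (reForm γ), T⁆ ∈ Submodule.span ℚ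
        {P : Module.End ℂ (GForm E ℂ) | ∃ γ ∈ rationalForms Φ 2, ∃ η : E [⋀^Fin 2]→L[ℝ] ℝ,
          ofRealForm η ∈ rationalForms Φ 2 ∧ (∀ v : E, v ≠ 0 → ∃ w : E, η ![v, w] ≠ 0) ∧
            ⁅lefschetzG (reForm γ), lefschetzDualG η⁆ = P}) ?_ ?_ ?_ ?_ hT
    · rintro _ ⟨η, hη, hnd, rfl⟩
      exact Submodule.subset_span ⟨γ, hγ, η, hη, hnd, rfl⟩
    · rw [Ring.lie_def, mul_zero, zero_mul, sub_zero]
      exact Submodule.zero_mem _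
    · intro T T' _ _ h h'
      rw [Ring.lie_def, mul_add, add_mul, add_sub_add_comm, ← Ring.lie_def, ← Ring.lie_def]
      exact Submodule.add_mem _ h h'
    · intro q T _ h
      rw [Ring.lie_def, mul_smul_comm, smul_mul_assoc, ← smul_sub, ← Ring.lie_def]
      exact Submodule.smul_mem _ _ h
  · rintro _ ⟨γ, hγ, η, hη, hnd, rfl⟩
    exact ⟨_, lefschetzG_reForm_mem_totalLieAlgebraRatDeg_two Φ hγ, _,
      lefschetzDualG_mem_totalLieAlgebraRatDeg_negTwo Φ hη hnd, rfl⟩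

/-- **(2.5) WITH (ii), EXPLICITLY: `𝔤_tot(X; ℚ) = span_ℚ f(dom f) + span_ℚ [e(𝔞), f(dom f)] + span_ℚ e(𝔞)`** (`g ≥ 2`) —
"`𝔤 = 𝔤₋₂ ⊕ 𝔤₀ ⊕ 𝔤₂`" with `𝔤₋₂ = span f(dom f)` (row A1-82), `𝔤₀ = [𝔤₂, 𝔤₋₂]` (row A1-79) and `𝔤₂ = e(𝔞)` (row A1-80), so that in
particular two brackets suffice to generate. [cite: LooijengaLunts1997, §1 (1.1) (ii), §2 (2.5), §3 (3.3)] -/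
theorem mem_totalLieAlgebraRat_iff_mem_sup_span_lefschetz (h2 : 2 ≤ finrank ℂ E) {T : Module.End ℂ (GForm E ℂ)} :
    T ∈ totalLieAlgebraRat Φ ↔ T ∈
      Submodule.span ℚ {T : Module.End ℂ (GForm E ℂ) | ∃ η : E [⋀^Fin 2]→L[ℝ] ℝ, ofRealForm η ∈ rationalForms Φ 2 ∧
          (∀ v : E, v ≠ 0 → ∃ w : E, η ![v, w] ≠ 0) ∧ T = lefschetzDualG η} ⊔
        Submodule.span ℚ {P : Module.End ℂ (GForm E ℂ) | ∃ γ ∈ rationalForms Φ 2, ∃ η : E [⋀^Fin 2]→L[ℝ] ℝ,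
          ofRealForm η ∈ rationalForms Φ 2 ∧ (∀ v : E, v ≠ 0 → ∃ w : E, η ![v, w] ≠ 0) ∧
            ⁅lefschetzG (reForm γ), lefschetzDualG η⁆ = P} ⊔
        Submodule.span ℚ {T : Module.End ℂ (GForm E ℂ) | ∃ γ ∈ rationalForms Φ 2, T = lefschetzG (reForm γ)} := by
  rw [mem_totalLieAlgebraRat_iff_mem_sup_span_lie Φ h2, span_lie_eq_span_lie_lefschetzG_lefschetzDualG Φ h2,
    totalLieAlgebraRatDeg_negTwo_eq_span_lefschetzDualG Φ h2, totalLieAlgebraRatDeg_two_eq_span_lefschetzG Φ]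

/-! ### Saturation: `𝔞 = H²(X; ℚ)` exhausts the `h`-degree-`2` part of `𝔤_tot(X; ℚ)` -/

omit [DecidableEq ι] in
/-- **SATURATION: every element of `𝔤_tot(X; ℚ)` of `h`-degree `2` — in particular the first member `e` of ANY `𝔰𝔩₂`-triple
`(e, h, f)` in `𝔤_tot(X; ℚ)`, for which `[h, e] = 2e` — is `e_γ` for a rational class `γ ∈ H²(X; ℚ)`**: no abelian `𝔞' ⊋ e(H²(X; ℚ))`
of degree-`2` elements exists, `𝔞 = H²(X; ℚ)` is maximal ("saturated"; every torus, row A1-80's `𝔤₂(ℚ) = e(H²(X; ℚ))`).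
[cite: LooijengaLunts1997, §1 (1.1) ("an associated Lefschetz triple (𝔤, h, 𝔞) is saturated if 𝔞 is maximal for this property"), §3 (3.3)] -/
theorem exists_eq_lefschetzG_reForm_of_lie_countingG_eq_two_smul {T : Module.End ℂ (GForm E ℂ)}
    (hT : T ∈ totalLieAlgebraRat Φ) (h2T : ⁅countingG E, T⁆ = 2 • T) :
    ∃ γ ∈ rationalForms Φ 2, T = lefschetzG (reForm γ) :=
  (mem_totalLieAlgebraRatDeg_two_iff_exists_reForm Φ).1
    ((mem_totalLieAlgebraRatDeg_iff Φ).2 ⟨hT, by rw [h2T, two_smul, two_smul]⟩)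

omit [DecidableEq ι] [Nontrivial E] in
/-- … and the class is unique: `e_{Re γ} = e_{Re γ'}` forces `γ = γ'` for rational classes (`e` is injective, row A1-80's
`eq_of_lefschetzG_eq`, and rational classes are real). [cite: LooijengaLunts1997, §1 (1.1), §2 (2.8)] -/
theorem eq_of_lefschetzG_reForm_eq {γ γ' : E [⋀^Fin 2]→L[ℝ] ℂ} (hγ : γ ∈ rationalForms Φ 2) (hγ' : γ' ∈ rationalForms Φ 2)
    (h : lefschetzG (reForm γ) = lefschetzG (reForm γ')) : γ = γ' := by
  rw [← ofRealForm_reForm_of_mem_rationalForms_two Φ hγ, ← ofRealForm_reForm_of_mem_rationalForms_two Φ hγ',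
    eq_of_lefschetzG_eq h]

end LefschetzTripleRat

end ComplexTorus

end Literature.Geometry.Kaehler
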